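import Summits.RiemannHypothesis.RiemannHypothesis.Theorems.PfPersistenceParityMassLawSharp
import Summits.RiemannHypothesis.RiemannHypothesis.Theorems.PfPersistenceHeavySlotMirrorNodal
import HarnessLib

/-!
# PF persistence — the PARITY-SPLITTING LAW: a dial heavier than the parity-splitting gap of the unperturbed block is
nodal at its mirror window (pub-rhpf, cand-6 gen 7)

**HONEST FRAMING. This is a long-odds MECHANISM SEARCH ('mechanism/rigidity campaign'); no RH claims.** Every statement
below is RH-free bookkeeping about the cell's observatory records (truncated Weil matrices of weight tables); nothing here
bears on the truth of RH. Labels: PROVED = kernel-checked here or in the imported tree files.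

THE QUESTION (leaves G1.01 / G1.02 / C4-I6 eo; rows C6-PARITY-MASS / C6-MIRROR-NODAL). The tree proves that a HEAVY dial —
`|K − 1| w(p) ≥ 3 ‖Q^±‖_F` — is rejected by the (floored) nodeless readers at its mirror window `a = log p`
(`heavyDial_not_mem_floorNodelessEOAt`, d7caf17db7a9), with the crude `1/8`, `1/16` parity-mass laws and a Frobenius bound.
Which LIGHTER dials are still provably nodal? This file replaces the crude threshold by the sharp one that the SHARP parity-mass
law (`parityMass_two_le_of_(floor)OneSigned`, `‖u‖² ≤ 2‖u^{ev}‖²`) actually supports.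

* §1 (PROVED) `uᵀ diag((−1)^i) u = 2‖u^{kept}‖² − ‖u‖²` — the alternating form IS the parity defect that the sharp law signs
  (even sector: `evenIdxPart`; odd sector: `oddModePart`, which keeps the EVEN coordinates `j` = the odd sine modes `n = j+1`).
* §2 **THE PARITY-SPLITTING LAW (PROVED, pure linear algebra):** for an eigenpair `(Q + t·S) u = λ u`, `S = diag((−1)^i)`:
  `t · uᵀSu ≤ (λ − ε₁(Q)) ‖u‖²` (`paritySplit_law`); and `ε₁(Q + t·S) ≤ ℓ − t` for every `ℓ ≥` the Rayleigh quotient of `Q`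
  at a vector supported on the ODD coordinates (`bottomRayleigh_add_smul_signDiag_le`). Hence for a BOTTOM vector:
  `t · (2‖u^{kept}‖² − ‖u‖²) ≤ (ℓ − t − ε₁(Q)) ‖u‖²`.
* §3 **REJECTION PAST THE GAP (PROVED):** if `ℓ − ε₁(Q) < (1 − δ) t`, `t ≥ 0`, then no bottom vector of `Q + t·S` has parity
  defect `≥ −δ‖u‖²`; with the floored sharp laws (`δ = (2φ+φ²)(2N+1)` even, `(2φ+φ²)·2N` odd) this gives, for every weight table
  `w`, slot `p ≥ 2`, mirror window `(log p, N)`, floor `φ ≥ 0`: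
  `downDial_not_mem_floorNodelessAt_of_paritySplit` — `(1 − K) w(p) ≥ 0` and `ℓ − ε₁(Q⁺) < (1 − δ)(1 − K) w(p)` for some
  odd-indexed test vector (`vᵀQ⁺v ≤ ℓ‖v‖²`) ⇒ `datumOf (dial p K w) ∉ floorNodelessAt φ win` (hence `∉ floorNodelessEOAt φ win`);
  `upDial_not_mem_floorNodelessOddAt_of_paritySplit` — the same in the odd block with `(K − 1) w(p)` and a test vector on the odd
  coordinates `i` (even sine modes `n = i+1`). THE NUMBER OF RECORD per `(w; p, N)` is the PARITY-SPLITTING GAP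
  `g^± := λ_min(Q^±|lowered class) − ε₁(Q^±)` (optimal `ℓ`); every dial with `|K − 1| w(p) (1 − δ) > g^±` of the matching sign is nodal.
* §4 (PROVED) the crude threshold is a COROLLARY with a better constant: `|vᵀQv| ≤ B‖v‖²` from `Σ Q_{ij}² ≤ B²`, so `ℓ = Q_{11} ≤ B`,
  `ε₁(Q) ≥ −B`, and `2B < (1 − δ) t` suffices (`heavyDownDial_not_mem_floorNodelessAt_two`; tree: `3B ≤ t` with `4φ²(2N+1) ≤ 1`).
* §5 (PROVED) NEGATIVITY of the witness along the same test vector: `vᵀQ⁺v < (1 − K) w(p) ‖v‖²` ⇒ the dial is NOT window-positive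
  at `(log p, N)` and is `DetectablyNegative` — so past `max(g⁺ /(1 − δ), ℓ)` the reader REJECTS a detectably negative RH-free datum
  (soundness on that family, by proof); `ζ` versions with `w = zetaWeights`, `p` prime.

What is NOT decided here (DATA): the size of `g^±(ζ; p, N)` — whether the served flips `K = −1` (`|K − 1| w(p) = 2w(p)`) lie past it —
and how far below `g^±` the true nodal onset sits. No closure, no separation claim.
-/

set_option linter.dupNamespace false  -- the mandated namespace repeats `RiemannHypothesis`

noncomputable section

open Real Set Matrix Finset

namespace Summit.RiemannHypothesis.RiemannHypothesis.Theorems.PfPersistence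

/-! ## §1 The alternating form is the parity defect -/

/-- PROVED: `(S u)_i = (−1)^i u_i`. [folklore] -/
theorem signDiag_mulVec_apply {m : ℕ} (u : Fin m → ℝ) (i : Fin m) :
    (signDiag m *ᵥ u) i = (-1 : ℝ) ^ (i : ℕ) * u i := by
  simp [signDiag, Matrix.mulVec_diagonal]

/-- PROVED (even sector, dimension `N+1`): `S u = flipVec u`. [folklore] -/
theorem signDiag_mulVec_eq_flipVec {N : ℕ} (u : Fin (N + 1) → ℝ) : signDiag (N + 1) *ᵥ u = flipVec u := by
  funext i; rw [signDiag_mulVec_apply]; rfl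

/-- PROVED (odd sector, dimension `N`): `S u = flipVecOdd u`. [folklore] -/
theorem signDiag_mulVec_eq_flipVecOdd {N : ℕ} (u : Fin N → ℝ) : signDiag N *ᵥ u = flipVecOdd u := by
  funext i; rw [signDiag_mulVec_apply]; rfl

/-- **PROVED (even sector):** `uᵀSu = 2‖u^{ev}‖² − ‖u‖²` — the alternating form is the parity defect. [folklore] -/
theorem dotProduct_signDiag_mulVec_even {N : ℕ} (u : Fin (N + 1) → ℝ) :
    u ⬝ᵥ (signDiag (N + 1) *ᵥ u) = 2 * (evenIdxPart u ⬝ᵥ evenIdxPart u) - u ⬝ᵥ u := by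
  rw [signDiag_mulVec_eq_flipVec, two_mul_evenMass_eq]; ring

/-- **PROVED (odd sector):** `uᵀSu = 2‖u^{om}‖² − ‖u‖²` (`oddModePart` keeps the EVEN coordinates `j`, i.e. the odd sine
modes `n = j+1`). [folklore] -/
theorem dotProduct_signDiag_mulVec_odd {N : ℕ} (u : Fin N → ℝ) :
    u ⬝ᵥ (signDiag N *ᵥ u) = 2 * (oddModePart u ⬝ᵥ oddModePart u) - u ⬝ᵥ u := by
  rw [signDiag_mulVec_eq_flipVecOdd, two_mul_oddModeMass_eq]; ring

/-- PROVED: on a vector supported on the ODD coordinates the alternating form is `−‖v‖²`. [folklore] -/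
theorem dotProduct_signDiag_mulVec_of_oddSupported {m : ℕ} {v : Fin m → ℝ} (hv : ∀ i : Fin m, Even (i : ℕ) → v i = 0) :
    v ⬝ᵥ (signDiag m *ᵥ v) = -(v ⬝ᵥ v) := by
  simp only [dotProduct, signDiag_mulVec_apply, ← Finset.sum_neg_distrib]
  refine Finset.sum_congr rfl fun i _ => ?_
  rcases Nat.even_or_odd (i : ℕ) with h | h
  · simp [hv i h]
  · rw [h.neg_one_pow]; ring

/-- PROVED: on a vector supported on the EVEN coordinates the alternating form is `+‖v‖²`. [folklore] -/
theorem dotProduct_signDiag_mulVec_of_evenSupported {m : ℕ} {v : Fin m → ℝ} (hv : ∀ i : Fin m, ¬Even (i : ℕ) → v i = 0) :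
    v ⬝ᵥ (signDiag m *ᵥ v) = v ⬝ᵥ v := by
  simp only [dotProduct, signDiag_mulVec_apply]
  refine Finset.sum_congr rfl fun i _ => ?_
  rcases Nat.even_or_odd (i : ℕ) with h | h
  · rw [h.neg_one_pow]; ring
  · simp [hv i (Nat.not_even_iff_odd.2 h)]

/-- PROVED: the form of `Q + t·S`. [folklore] -/
theorem form_add_smul_signDiag {m : ℕ} (Q : Matrix (Fin m) (Fin m) ℝ) (t : ℝ) (v : Fin m → ℝ) :
    v ⬝ᵥ ((Q + t • signDiag m) *ᵥ v) = v ⬝ᵥ (Q *ᵥ v) + t * (v ⬝ᵥ (signDiag m *ᵥ v)) := by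
  rw [Matrix.add_mulVec, Matrix.smul_mulVec, dotProduct_add, dotProduct_smul, smul_eq_mul]

/-! ## §2 The parity-splitting law -/

/-- **PROVED — THE PARITY-SPLITTING LAW:** for an eigenpair `(Q + t·S) u = λ u`, `t · uᵀSu ≤ (λ − ε₁(Q)) ‖u‖²`. [folklore] -/
theorem paritySplit_law {m : ℕ} (Q : Matrix (Fin m) (Fin m) ℝ) {t lam : ℝ} {u : Fin m → ℝ}
    (hE : (Q + t • signDiag m) *ᵥ u = lam • u) :
    t * (u ⬝ᵥ (signDiag m *ᵥ u)) ≤ (lam - bottomRayleigh Q) * (u ⬝ᵥ u) := by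
  have h1 : u ⬝ᵥ ((Q + t • signDiag m) *ᵥ u) = lam * (u ⬝ᵥ u) := by rw [hE, dotProduct_smul, smul_eq_mul]
  rw [form_add_smul_signDiag] at h1
  have h2 := bottomRayleigh_mul_le_form Q u
  linarith

/-- **PROVED — UPPER BOUND FROM THE LOWERED CLASS:** if `v ≠ 0` is supported on the odd coordinates and `vᵀQv ≤ ℓ‖v‖²` then
`ε₁(Q + t·S) ≤ ℓ − t`. [folklore] -/
theorem bottomRayleigh_add_smul_signDiag_le {m : ℕ} (Q : Matrix (Fin m) (Fin m) ℝ) (t : ℝ) {v : Fin m → ℝ} (hv0 : v ≠ 0)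
    (hv : ∀ i : Fin m, Even (i : ℕ) → v i = 0) {ℓ : ℝ} (hℓ : v ⬝ᵥ (Q *ᵥ v) ≤ ℓ * (v ⬝ᵥ v)) :
    bottomRayleigh (Q + t • signDiag m) ≤ ℓ - t := by
  have hvv : 0 < v ⬝ᵥ v :=
    lt_of_le_of_ne (dotProduct_self_nonneg_real v) fun h => hv0 (dotProduct_self_eq_zero.1 h.symm)
  have h := bottomRayleigh_mul_le_form (Q + t • signDiag m) v
  rw [form_add_smul_signDiag, dotProduct_signDiag_mulVec_of_oddSupported hv] at h
  have h' : bottomRayleigh (Q + t • signDiag m) * (v ⬝ᵥ v) ≤ (ℓ - t) * (v ⬝ᵥ v) := by linarith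
  exact le_of_mul_le_mul_right h' hvv

/-- PROVED (mirror image): if `v ≠ 0` is supported on the even coordinates and `vᵀQv ≤ ℓ‖v‖²` then `ε₁(Q + t·S) ≤ ℓ + t`. [folklore] -/
theorem bottomRayleigh_add_smul_signDiag_le' {m : ℕ} (Q : Matrix (Fin m) (Fin m) ℝ) (t : ℝ) {v : Fin m → ℝ} (hv0 : v ≠ 0)
    (hv : ∀ i : Fin m, ¬Even (i : ℕ) → v i = 0) {ℓ : ℝ} (hℓ : v ⬝ᵥ (Q *ᵥ v) ≤ ℓ * (v ⬝ᵥ v)) :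
    bottomRayleigh (Q + t • signDiag m) ≤ ℓ + t := by
  have hvv : 0 < v ⬝ᵥ v :=
    lt_of_le_of_ne (dotProduct_self_nonneg_real v) fun h => hv0 (dotProduct_self_eq_zero.1 h.symm)
  have h := bottomRayleigh_mul_le_form (Q + t • signDiag m) v
  rw [form_add_smul_signDiag, dotProduct_signDiag_mulVec_of_evenSupported hv] at h
  have h' : bottomRayleigh (Q + t • signDiag m) * (v ⬝ᵥ v) ≤ (ℓ + t) * (v ⬝ᵥ v) := by linarith
  exact le_of_mul_le_mul_right h' hvv

/-- **PROVED — THE LAW FOR A BOTTOM VECTOR:** `t · uᵀSu ≤ (ℓ − t − ε₁(Q)) ‖u‖²` for every bottom vector `u` of `Q + t·S` and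
every odd-supported test bound `ℓ`. [folklore] -/
theorem paritySplit_bottom {m : ℕ} (Q : Matrix (Fin m) (Fin m) ℝ) {t : ℝ} {u : Fin m → ℝ}
    (hu : IsBottomVector (Q + t • signDiag m) u) {v : Fin m → ℝ} (hv0 : v ≠ 0)
    (hv : ∀ i : Fin m, Even (i : ℕ) → v i = 0) {ℓ : ℝ} (hℓ : v ⬝ᵥ (Q *ᵥ v) ≤ ℓ * (v ⬝ᵥ v)) :
    t * (u ⬝ᵥ (signDiag m *ᵥ u)) ≤ (ℓ - t - bottomRayleigh Q) * (u ⬝ᵥ u) := by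
  have h1 := paritySplit_law Q hu.2
  have h2 := bottomRayleigh_add_smul_signDiag_le Q t hv0 hv hℓ
  have h3 : (bottomRayleigh (Q + t • signDiag m) - bottomRayleigh Q) * (u ⬝ᵥ u) ≤ (ℓ - t - bottomRayleigh Q) * (u ⬝ᵥ u) :=
    mul_le_mul_of_nonneg_right (by linarith) (dotProduct_self_nonneg_real u)
  exact h1.trans h3

/-- PROVED: the parity-splitting gap is nonnegative — `ε₁(Q) ≤ ℓ` for every test bound `ℓ`. [folklore] -/
theorem bottomRayleigh_le_of_testBound {m : ℕ} (Q : Matrix (Fin m) (Fin m) ℝ) {v : Fin m → ℝ} (hv0 : v ≠ 0) {ℓ : ℝ}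
    (hℓ : v ⬝ᵥ (Q *ᵥ v) ≤ ℓ * (v ⬝ᵥ v)) : bottomRayleigh Q ≤ ℓ := by
  have hvv : 0 < v ⬝ᵥ v :=
    lt_of_le_of_ne (dotProduct_self_nonneg_real v) fun h => hv0 (dotProduct_self_eq_zero.1 h.symm)
  exact le_of_mul_le_mul_right ((bottomRayleigh_mul_le_form Q v).trans hℓ) hvv

/-! ## §3 Rejection past the gap -/

/-- **PROVED — NO NEAR-BALANCED BOTTOM VECTOR PAST THE GAP:** if `ℓ − ε₁(Q) < (1 − δ) t`, `t ≥ 0`, then a bottom vector of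
`Q + t·S` cannot have parity defect `uᵀSu ≥ −δ‖u‖²`. [folklore] -/
theorem paritySplit_contra {m : ℕ} (Q : Matrix (Fin m) (Fin m) ℝ) {t δ : ℝ} (ht : 0 ≤ t) {u : Fin m → ℝ}
    (hu : IsBottomVector (Q + t • signDiag m) u) {v : Fin m → ℝ} (hv0 : v ≠ 0)
    (hv : ∀ i : Fin m, Even (i : ℕ) → v i = 0) {ℓ : ℝ} (hℓ : v ⬝ᵥ (Q *ᵥ v) ≤ ℓ * (v ⬝ᵥ v))
    (hsplit : ℓ - bottomRayleigh Q < (1 - δ) * t) (hdef : -(δ * (u ⬝ᵥ u)) ≤ u ⬝ᵥ (signDiag m *ᵥ u)) : False := by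
  have huu : 0 < u ⬝ᵥ u :=
    lt_of_le_of_ne (dotProduct_self_nonneg_real u) fun h => hu.1 (dotProduct_self_eq_zero.1 h.symm)
  have h1 := paritySplit_bottom Q hu hv0 hv hℓ
  have h2 : t * -(δ * (u ⬝ᵥ u)) ≤ t * (u ⬝ᵥ (signDiag m *ᵥ u)) := mul_le_mul_of_nonneg_left hdef ht
  have h3 : -(t * δ) * (u ⬝ᵥ u) ≤ (ℓ - t - bottomRayleigh Q) * (u ⬝ᵥ u) := by
    calc -(t * δ) * (u ⬝ᵥ u) = t * -(δ * (u ⬝ᵥ u)) := by ring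
      _ ≤ (ℓ - t - bottomRayleigh Q) * (u ⬝ᵥ u) := h2.trans h1
  have h4 : -(t * δ) ≤ ℓ - t - bottomRayleigh Q := le_of_mul_le_mul_right h3 huu
  linarith

/-- **PROVED (even sector, abstract):** past the gap no bottom vector of `Q + t·S` (dimension `N+1`) is `φ`-floor one-signed on a
window of length `L > 0` (`δ = (2φ+φ²)(2N+1)`, the floored SHARP parity-mass law). [folklore] -/
theorem not_floorOneSigned_of_paritySplit {L φ : ℝ} (hL : 0 < L) (hφ : 0 ≤ φ) {N : ℕ}
    (Q : Matrix (Fin (N + 1)) (Fin (N + 1)) ℝ) {t : ℝ} (ht : 0 ≤ t) {u : Fin (N + 1) → ℝ}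
    (hu : IsBottomVector (Q + t • signDiag (N + 1)) u) {v : Fin (N + 1) → ℝ} (hv0 : v ≠ 0)
    (hv : ∀ i : Fin (N + 1), Even (i : ℕ) → v i = 0) {ℓ : ℝ} (hℓ : v ⬝ᵥ (Q *ᵥ v) ≤ ℓ * (v ⬝ᵥ v))
    (hsplit : ℓ - bottomRayleigh Q < (1 - (2 * φ + φ ^ 2) * (2 * N + 1)) * t) :
    ¬FloorOneSigned L φ u := by
  intro hfloor
  have hmass := parityMass_two_le_of_floorOneSigned hL hφ hfloor
  refine paritySplit_contra Q ht hu hv0 hv hℓ hsplit ?_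
  rw [dotProduct_signDiag_mulVec_even]
  linarith

/-- **PROVED (odd sector, abstract):** past the gap no bottom vector of `Q + c·S` (dimension `N`) is `φ`-floor one-signed on `H`
(`δ = (2φ+φ²)·2N`, the floored SHARP odd parity-mass law; the test vector sits on the odd coordinates `i` = even modes `n = i+1`). [folklore] -/
theorem not_floorOneSignedOdd_of_paritySplit {L φ : ℝ} (hL : 0 < L) (hφ : 0 ≤ φ) {N : ℕ}
    (Q : Matrix (Fin N) (Fin N) ℝ) {c : ℝ} (hc : 0 ≤ c) {u : Fin N → ℝ}
    (hu : IsBottomVector (Q + c • signDiag N) u) {v : Fin N → ℝ} (hv0 : v ≠ 0)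
    (hv : ∀ i : Fin N, Even (i : ℕ) → v i = 0) {ℓ : ℝ} (hℓ : v ⬝ᵥ (Q *ᵥ v) ≤ ℓ * (v ⬝ᵥ v))
    (hsplit : ℓ - bottomRayleigh Q < (1 - (2 * φ + φ ^ 2) * (2 * N)) * c) :
    ¬FloorOneSignedOdd L φ u := by
  intro hfloor
  have hmass := parityMassOdd_two_le_of_floorOneSignedOdd hL hφ hfloor
  refine paritySplit_contra Q hc hu hv0 hv hℓ hsplit ?_
  rw [dotProduct_signDiag_mulVec_odd]
  linarith

/-- **PROVED — DOWN DIALS PAST THE PARITY-SPLITTING GAP ARE NODAL IN THE EVEN SECTOR AT THEIR MIRROR WINDOW.** For every weight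
table `w`, slot `p ≥ 2`, window `win` with `win.a = log p`, floor `φ ≥ 0`, and every test vector `v ≠ 0` supported on the
ODD-indexed cosine modes with `vᵀQ⁺v ≤ ℓ‖v‖²` (`Q⁺ = evenBlock w win`): if `(1 − K) w(p) ≥ 0` and
`ℓ − ε₁(Q⁺) < (1 − (2φ+φ²)(2N+1)) (1 − K) w(p)` then NO bottom vector of the dial's even block is `φ`-floor one-signed. [folklore] -/
theorem downDial_not_mem_floorNodelessAt_of_paritySplit {p : ℕ} (hp : 2 ≤ p) {win : Window} (hwin : win.a = Real.log p)
    (w : Weights) {K φ : ℝ} (hφ : 0 ≤ φ) (ht : 0 ≤ (1 - K) * w p) {v : Fin (win.N + 1) → ℝ} (hv0 : v ≠ 0)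
    (hv : ∀ i : Fin (win.N + 1), Even (i : ℕ) → v i = 0) {ℓ : ℝ} (hℓ : v ⬝ᵥ (evenBlock w win *ᵥ v) ≤ ℓ * (v ⬝ᵥ v))
    (hsplit : ℓ - bottomRayleigh (evenBlock w win) < (1 - (2 * φ + φ ^ 2) * (2 * win.N + 1)) * ((1 - K) * w p)) :
    datumOf (dial p K w) ∉ floorNodelessAt φ win := by
  rintro ⟨u, hbv, hfloor⟩
  have hblock : datumOf (dial p K w) win = evenBlock w win + ((1 - K) * w p) • signDiag (win.N + 1) :=
    evenBlock_dial_mirror' hp hwin K w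
  have hbv' : IsBottomVector (evenBlock w win + ((1 - K) * w p) • signDiag (win.N + 1)) u := by
    rw [← hblock]; exact hbv
  have ha : 0 < 2 * win.a := by linarith [win.ha]
  exact not_floorOneSigned_of_paritySplit ha hφ (evenBlock w win) ht hbv' hv0 hv hℓ hsplit hfloor

/-- **PROVED — UP DIALS PAST THE PARITY-SPLITTING GAP ARE NODAL IN THE ODD SECTOR AT THEIR MIRROR WINDOW** (`Q⁻ = oddBlock w win`,
test vector on the odd coordinates `i` = even sine modes `n = i+1`, `δ = (2φ+φ²)·2N`, size `(K − 1) w(p) ≥ 0`). [folklore] -/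
theorem upDial_not_mem_floorNodelessOddAt_of_paritySplit {p : ℕ} (hp : 2 ≤ p) {win : Window} (hwin : win.a = Real.log p)
    (w : Weights) {K φ : ℝ} (hφ : 0 ≤ φ) (hc : 0 ≤ (K - 1) * w p) {v : Fin win.N → ℝ} (hv0 : v ≠ 0)
    (hv : ∀ i : Fin win.N, Even (i : ℕ) → v i = 0) {ℓ : ℝ} (hℓ : v ⬝ᵥ (oddBlock w win *ᵥ v) ≤ ℓ * (v ⬝ᵥ v))
    (hsplit : ℓ - bottomRayleigh (oddBlock w win) < (1 - (2 * φ + φ ^ 2) * (2 * win.N)) * ((K - 1) * w p)) :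
    datumOf (dial p K w) ∉ floorNodelessOddAt φ win := by
  rintro ⟨u, hbv, hfloor⟩
  have hblock : oddDatum (datumOf (dial p K w)) win = oddBlock w win + ((K - 1) * w p) • signDiag win.N := by
    rw [oddDatum_datumOf, oddBlock_dial_mirror hp hwin]
  have hbv' : IsBottomVector (oddBlock w win + ((K - 1) * w p) • signDiag win.N) u := by
    rw [← hblock]; exact hbv
  have ha : 0 < 2 * win.a := by linarith [win.ha]
  exact not_floorOneSignedOdd_of_paritySplit ha hφ (oddBlock w win) hc hbv' hv0 hv hℓ hsplit hfloor

/-- PROVED (two-parity handle, down sign): the same hypotheses reject the dial from `floorNodelessEOAt φ win`. [folklore] -/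
theorem downDial_not_mem_floorNodelessEOAt_of_paritySplit {p : ℕ} (hp : 2 ≤ p) {win : Window} (hwin : win.a = Real.log p)
    (w : Weights) {K φ : ℝ} (hφ : 0 ≤ φ) (ht : 0 ≤ (1 - K) * w p) {v : Fin (win.N + 1) → ℝ} (hv0 : v ≠ 0)
    (hv : ∀ i : Fin (win.N + 1), Even (i : ℕ) → v i = 0) {ℓ : ℝ} (hℓ : v ⬝ᵥ (evenBlock w win *ᵥ v) ≤ ℓ * (v ⬝ᵥ v))
    (hsplit : ℓ - bottomRayleigh (evenBlock w win) < (1 - (2 * φ + φ ^ 2) * (2 * win.N + 1)) * ((1 - K) * w p)) :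
    datumOf (dial p K w) ∉ floorNodelessEOAt φ win :=
  fun h => downDial_not_mem_floorNodelessAt_of_paritySplit hp hwin w hφ ht hv0 hv hℓ hsplit h.1

/-- PROVED (two-parity handle, up sign). [folklore] -/
theorem upDial_not_mem_floorNodelessEOAt_of_paritySplit {p : ℕ} (hp : 2 ≤ p) {win : Window} (hwin : win.a = Real.log p)
    (w : Weights) {K φ : ℝ} (hφ : 0 ≤ φ) (hc : 0 ≤ (K - 1) * w p) {v : Fin win.N → ℝ} (hv0 : v ≠ 0)
    (hv : ∀ i : Fin win.N, Even (i : ℕ) → v i = 0) {ℓ : ℝ} (hℓ : v ⬝ᵥ (oddBlock w win *ᵥ v) ≤ ℓ * (v ⬝ᵥ v))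
    (hsplit : ℓ - bottomRayleigh (oddBlock w win) < (1 - (2 * φ + φ ^ 2) * (2 * win.N)) * ((K - 1) * w p)) :
    datumOf (dial p K w) ∉ floorNodelessEOAt φ win :=
  fun h => upDial_not_mem_floorNodelessOddAt_of_paritySplit hp hwin w hφ hc hv0 hv hℓ hsplit h.2

/-! ## §4 The crude Frobenius threshold as a corollary, constant `2` -/

/-- PROVED: `|vᵀQv| ≤ B ‖v‖²` whenever `Σ Q_{ij}² ≤ B²`, `B ≥ 0` (Cauchy–Schwarz twice). [folklore] -/
theorem abs_form_le_of_sum_sq_le {m : ℕ} {Q : Matrix (Fin m) (Fin m) ℝ} {B : ℝ} (hB0 : 0 ≤ B)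
    (hB : ∑ i, ∑ j, Q i j ^ 2 ≤ B ^ 2) (v : Fin m → ℝ) : |v ⬝ᵥ (Q *ᵥ v)| ≤ B * (v ⬝ᵥ v) := by
  have hvv : 0 ≤ v ⬝ᵥ v := dotProduct_self_nonneg_real v
  have huu : v ⬝ᵥ v = ∑ j, v j ^ 2 := by simp [dotProduct, sq]
  -- `‖Qv‖² ≤ (Σ Q²) ‖v‖²`
  have hQv : (Q *ᵥ v) ⬝ᵥ (Q *ᵥ v) ≤ (∑ i, ∑ j, Q i j ^ 2) * (v ⬝ᵥ v) := by
    have : (Q *ᵥ v) ⬝ᵥ (Q *ᵥ v) = ∑ i, (Q *ᵥ v) i ^ 2 := by simp [dotProduct, sq]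
    rw [this, Finset.sum_mul]
    refine Finset.sum_le_sum fun i _ => ?_
    have hcs := Finset.sum_mul_sq_le_sq_mul_sq Finset.univ (fun j => Q i j) v
    rw [huu]
    simpa [Matrix.mulVec, dotProduct] using hcs
  -- `(vᵀQv)² ≤ ‖v‖² ‖Qv‖²`
  have hcs2 : (v ⬝ᵥ (Q *ᵥ v)) ^ 2 ≤ (v ⬝ᵥ v) * ((Q *ᵥ v) ⬝ᵥ (Q *ᵥ v)) := by
    have h := Finset.sum_mul_sq_le_sq_mul_sq Finset.univ v (Q *ᵥ v)
    simpa [dotProduct, sq] using h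
  have hsq : (v ⬝ᵥ (Q *ᵥ v)) ^ 2 ≤ (B * (v ⬝ᵥ v)) ^ 2 := by
    calc (v ⬝ᵥ (Q *ᵥ v)) ^ 2 ≤ (v ⬝ᵥ v) * ((Q *ᵥ v) ⬝ᵥ (Q *ᵥ v)) := hcs2
      _ ≤ (v ⬝ᵥ v) * ((∑ i, ∑ j, Q i j ^ 2) * (v ⬝ᵥ v)) := mul_le_mul_of_nonneg_left hQv hvv
      _ ≤ (v ⬝ᵥ v) * (B ^ 2 * (v ⬝ᵥ v)) := mul_le_mul_of_nonneg_left (mul_le_mul_of_nonneg_right hB hvv) hvv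
      _ = (B * (v ⬝ᵥ v)) ^ 2 := by ring
  exact abs_le_of_sq_le_sq hsq (mul_nonneg hB0 hvv)

/-- PROVED: `−B ≤ ε₁(Q)` under the same bound (positive dimension). [folklore] -/
theorem neg_le_bottomRayleigh_of_sum_sq_le {n : ℕ} {Q : Matrix (Fin (n + 1)) (Fin (n + 1)) ℝ} {B : ℝ} (hB0 : 0 ≤ B)
    (hB : ∑ i, ∑ j, Q i j ^ 2 ≤ B ^ 2) : -B ≤ bottomRayleigh Q := by
  refine le_bottomRayleigh_of_forall Q fun v hv => ?_
  have hvv : 0 < v ⬝ᵥ v := lt_of_le_of_ne (dotProduct_self_nonneg_real v) fun h => hv (dotProduct_self_eq_zero.1 h.symm)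
  rw [le_div_iff₀ hvv]
  have h := abs_form_le_of_sum_sq_le hB0 hB v
  have := neg_abs_le (v ⬝ᵥ (Q *ᵥ v))
  linarith

/-- **PROVED — THE CRUDE THRESHOLD WITH CONSTANT 2:** `N ≥ 1`, `Σ Q⁺_{ij}² ≤ B²`, `(1 − K) w(p) ≥ 0` and
`2B < (1 − (2φ+φ²)(2N+1)) (1 − K) w(p)` ⇒ the down dial is not in `floorNodelessAt φ` at its mirror window
(tree, d7caf17db7a9: `3B ≤ (1 − K) w(p)` under `4φ²(2N+1) ≤ 1`). [folklore] -/
theorem heavyDownDial_not_mem_floorNodelessAt_two {p : ℕ} (hp : 2 ≤ p) {win : Window} (hwin : win.a = Real.log p)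
    (hN : 1 ≤ win.N) (w : Weights) {K B φ : ℝ} (hφ : 0 ≤ φ) (hB0 : 0 ≤ B)
    (hB : ∑ i, ∑ j, evenBlock w win i j ^ 2 ≤ B ^ 2) (ht : 0 ≤ (1 - K) * w p)
    (h2B : 2 * B < (1 - (2 * φ + φ ^ 2) * (2 * win.N + 1)) * ((1 - K) * w p)) :
    datumOf (dial p K w) ∉ floorNodelessAt φ win := by
  let i₀ : Fin (win.N + 1) := ⟨1, by omega⟩
  have hv0 : (Pi.single i₀ (1 : ℝ) : Fin (win.N + 1) → ℝ) ≠ 0 := by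
    intro h; have := congr_fun h i₀; simp at this
  have hv : ∀ i : Fin (win.N + 1), Even (i : ℕ) → (Pi.single i₀ (1 : ℝ) : Fin (win.N + 1) → ℝ) i = 0 := by
    intro i hi
    have hne : i ≠ i₀ := by rintro rfl; simp [i₀] at hi
    simp [hne]
  have hℓ : (Pi.single i₀ (1 : ℝ) : Fin (win.N + 1) → ℝ) ⬝ᵥ (evenBlock w win *ᵥ Pi.single i₀ 1)
      ≤ B * ((Pi.single i₀ (1 : ℝ) : Fin (win.N + 1) → ℝ) ⬝ᵥ Pi.single i₀ 1) := by
    rw [single_form_single, single_dotProduct, Pi.single_eq_same]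
    have := apply_le_of_sum_sq_le hB0 hB i₀ i₀
    linarith
  have hε := neg_le_bottomRayleigh_of_sum_sq_le hB0 hB
  refine downDial_not_mem_floorNodelessAt_of_paritySplit hp hwin w hφ ht hv0 hv hℓ ?_
  linarith

/-! ## §5 Negativity of the witness along the same test vector -/

/-- **PROVED — NEGATIVITY PAST THE LOWERED-CLASS VALUE (down sign):** if `vᵀQ⁺v < (1 − K) w(p) ‖v‖²` for a test vector on the
odd-indexed modes, the dial is NOT window-positive at its mirror window and is detectably negative (witness `v`). [folklore] -/
theorem downDial_negative_of_oddSupported {p : ℕ} (hp : 2 ≤ p) {win : Window} (hwin : win.a = Real.log p) (w : Weights)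
    {K : ℝ} {v : Fin (win.N + 1) → ℝ} (hv : ∀ i : Fin (win.N + 1), Even (i : ℕ) → v i = 0)
    (hneg : v ⬝ᵥ (evenBlock w win *ᵥ v) < (1 - K) * w p * (v ⬝ᵥ v)) :
    ¬WindowPositive (datumOf (dial p K w) win) ∧ DetectablyNegative (datumOf (dial p K w)) := by
  have hblock : datumOf (dial p K w) win = evenBlock w win + ((1 - K) * w p) • signDiag (win.N + 1) :=
    evenBlock_dial_mirror' hp hwin K w
  have hval : v ⬝ᵥ (datumOf (dial p K w) win *ᵥ v) < 0 := by
    rw [hblock, form_add_smul_signDiag, dotProduct_signDiag_mulVec_of_oddSupported hv]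
    linarith
  exact ⟨fun hW => absurd (hW v) (not_le.2 hval), win, v, hval⟩

/-- PROVED (up sign): if `vᵀQ⁺v < (K − 1) w(p) ‖v‖²` for a test vector on the EVEN-indexed modes, the up dial is not
window-positive at its mirror window and is detectably negative. [folklore] -/
theorem upDial_negative_of_evenSupported {p : ℕ} (hp : 2 ≤ p) {win : Window} (hwin : win.a = Real.log p) (w : Weights)
    {K : ℝ} {v : Fin (win.N + 1) → ℝ} (hv : ∀ i : Fin (win.N + 1), ¬Even (i : ℕ) → v i = 0)
    (hneg : v ⬝ᵥ (evenBlock w win *ᵥ v) < (K - 1) * w p * (v ⬝ᵥ v)) :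
    ¬WindowPositive (datumOf (dial p K w) win) ∧ DetectablyNegative (datumOf (dial p K w)) := by
  have hblock : datumOf (dial p K w) win = evenBlock w win + ((1 - K) * w p) • signDiag (win.N + 1) :=
    evenBlock_dial_mirror' hp hwin K w
  have hval : v ⬝ᵥ (datumOf (dial p K w) win *ᵥ v) < 0 := by
    rw [hblock, form_add_smul_signDiag, dotProduct_signDiag_mulVec_of_evenSupported hv]
    nlinarith
  exact ⟨fun hW => absurd (hW v) (not_le.2 hval), win, v, hval⟩

/-- **PROVED — SOUND-BY-PROOF ON THE FAMILY PAST THE GAP (down sign):** with one odd-indexed test vector `v ≠ 0`,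
`vᵀQ⁺v ≤ ℓ‖v‖²`, `0 ≤ (1 − K) w(p)`, `ℓ < (1 − K) w(p)` and `ℓ − ε₁(Q⁺) < (1 − δ)(1 − K) w(p)`: the dial is detectably negative AND rejected by the
floored even / two-parity nodeless readers at `(log p, N)`. [folklore] -/
theorem downDial_negative_and_rejected {p : ℕ} (hp : 2 ≤ p) {win : Window} (hwin : win.a = Real.log p)
    (w : Weights) {K φ : ℝ} (hφ : 0 ≤ φ) {v : Fin (win.N + 1) → ℝ} (hv0 : v ≠ 0)
    (hv : ∀ i : Fin (win.N + 1), Even (i : ℕ) → v i = 0) {ℓ : ℝ} (hℓ : v ⬝ᵥ (evenBlock w win *ᵥ v) ≤ ℓ * (v ⬝ᵥ v))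
    (ht : 0 ≤ (1 - K) * w p) (hℓt : ℓ < (1 - K) * w p)
    (hsplit : ℓ - bottomRayleigh (evenBlock w win) < (1 - (2 * φ + φ ^ 2) * (2 * win.N + 1)) * ((1 - K) * w p)) :
    DetectablyNegative (datumOf (dial p K w)) ∧ ¬WindowPositive (datumOf (dial p K w) win) ∧
      datumOf (dial p K w) ∉ floorNodelessAt φ win ∧ datumOf (dial p K w) ∉ floorNodelessEOAt φ win := by
  have hvv : 0 < v ⬝ᵥ v :=
    lt_of_le_of_ne (dotProduct_self_nonneg_real v) fun h => hv0 (dotProduct_self_eq_zero.1 h.symm)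
  have hneg : v ⬝ᵥ (evenBlock w win *ᵥ v) < (1 - K) * w p * (v ⬝ᵥ v) :=
    hℓ.trans_lt (mul_lt_mul_of_pos_right hℓt hvv)
  obtain ⟨hW, hD⟩ := downDial_negative_of_oddSupported hp hwin w hv hneg
  exact ⟨hD, hW, downDial_not_mem_floorNodelessAt_of_paritySplit hp hwin w hφ ht hv0 hv hℓ hsplit,
    downDial_not_mem_floorNodelessEOAt_of_paritySplit hp hwin w hφ ht hv0 hv hℓ hsplit⟩

/-- **PROVED — SOUND-BY-PROOF ON THE FAMILY PAST THE GAP (up sign):** negativity from an EVEN-indexed test vector `v'` of the even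
block (`v'ᵀQ⁺v' ≤ ℓ'‖v'‖²`, `ℓ' < (K − 1) w(p)`), rejection from an odd-coordinate test vector `v` of the odd block past the odd gap. [folklore] -/
theorem upDial_negative_and_rejected {p : ℕ} (hp : 2 ≤ p) {win : Window} (hwin : win.a = Real.log p)
    (w : Weights) {K φ : ℝ} (hφ : 0 ≤ φ) (hc : 0 ≤ (K - 1) * w p)
    {v' : Fin (win.N + 1) → ℝ} (hv'0 : v' ≠ 0) (hv' : ∀ i : Fin (win.N + 1), ¬Even (i : ℕ) → v' i = 0) {ℓ' : ℝ}
    (hℓ' : v' ⬝ᵥ (evenBlock w win *ᵥ v') ≤ ℓ' * (v' ⬝ᵥ v')) (hℓ't : ℓ' < (K - 1) * w p)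
    {v : Fin win.N → ℝ} (hv0 : v ≠ 0) (hv : ∀ i : Fin win.N, Even (i : ℕ) → v i = 0) {ℓ : ℝ}
    (hℓ : v ⬝ᵥ (oddBlock w win *ᵥ v) ≤ ℓ * (v ⬝ᵥ v))
    (hsplit : ℓ - bottomRayleigh (oddBlock w win) < (1 - (2 * φ + φ ^ 2) * (2 * win.N)) * ((K - 1) * w p)) :
    DetectablyNegative (datumOf (dial p K w)) ∧ ¬WindowPositive (datumOf (dial p K w) win) ∧
      datumOf (dial p K w) ∉ floorNodelessOddAt φ win ∧ datumOf (dial p K w) ∉ floorNodelessEOAt φ win := by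
  have hvv : 0 < v' ⬝ᵥ v' :=
    lt_of_le_of_ne (dotProduct_self_nonneg_real v') fun h => hv'0 (dotProduct_self_eq_zero.1 h.symm)
  have hneg : v' ⬝ᵥ (evenBlock w win *ᵥ v') < (K - 1) * w p * (v' ⬝ᵥ v') :=
    hℓ'.trans_lt (mul_lt_mul_of_pos_right hℓ't hvv)
  obtain ⟨hW, hD⟩ := upDial_negative_of_evenSupported hp hwin w hv' hneg
  exact ⟨hD, hW, upDial_not_mem_floorNodelessOddAt_of_paritySplit hp hwin w hφ hc hv0 hv hℓ hsplit,
    upDial_not_mem_floorNodelessEOAt_of_paritySplit hp hwin w hφ hc hv0 hv hℓ hsplit⟩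

/-- **PROVED — FOR `ζ` (down sign, `p` prime):** writing the hypotheses on `ζ`'s even block `Q⁺ = evenBlock zetaWeights win` at the
mirror window and `t = (1 − K) · Λ(p) p^{-1/2}`, `K ≤ 1`: one odd-indexed test vector with `vᵀQ⁺v ≤ ℓ‖v‖²`, `ℓ < t`,
`ℓ − ε₁(Q⁺) < (1 − (2φ+φ²)(2N+1)) t` ⇒ the `p`-dial `K` of `ζ` is detectably negative and rejected by `floorNodelessAt φ` and
`floorNodelessEOAt φ` at `(log p, N)`. RH-free; the only inputs are two Rayleigh numbers of `ζ`'s unperturbed block. [folklore] -/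
theorem zeta_downDial_negative_and_rejected {p : ℕ} (hp : p.Prime) {win : Window} (hwin : win.a = Real.log p)
    {K φ : ℝ} (hφ : 0 ≤ φ) {v : Fin (win.N + 1) → ℝ} (hv0 : v ≠ 0)
    (hv : ∀ i : Fin (win.N + 1), Even (i : ℕ) → v i = 0) {ℓ : ℝ}
    (hℓ : v ⬝ᵥ (evenBlock zetaWeights win *ᵥ v) ≤ ℓ * (v ⬝ᵥ v)) (hK : K ≤ 1) (hℓt : ℓ < (1 - K) * zetaWeights p)
    (hsplit : ℓ - bottomRayleigh (evenBlock zetaWeights win)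
      < (1 - (2 * φ + φ ^ 2) * (2 * win.N + 1)) * ((1 - K) * zetaWeights p)) :
    DetectablyNegative (datumOf (dial p K zetaWeights)) ∧ ¬WindowPositive (datumOf (dial p K zetaWeights) win) ∧
      datumOf (dial p K zetaWeights) ∉ floorNodelessAt φ win ∧ datumOf (dial p K zetaWeights) ∉ floorNodelessEOAt φ win :=
  downDial_negative_and_rejected hp.two_le hwin zetaWeights hφ hv0 hv hℓ
    (mul_nonneg (by linarith) (zetaWeights_pos_of_prime hp).le) hℓt hsplit

end Summit.RiemannHypothesis.RiemannHypothesis.Theorems.PfPersistence
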